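import Mathlib
import Summits.Ventures.HodgeRepro2.T5EquivariantDescent
import Summits.Ventures.HodgeRepro2.T5EquivariantWedge
import Summits.Ventures.HodgeRepro2.T5TopFormCharacter

/-!
# T5WedgeScalarType — the (2,0)-scalar `F ∧ F′` on `Γ\G` has `K`-type `topChar` (N1 ID-4(b)–(c))

Blind cell `pub-hodge-repro2`, Tier-5 support for sub-step N1 (route/T5-ID-p2.md, Theorem ID(iv)).
Assembly of three accepted files: two `K`-equivariant covector-valued functions `F, F′ : Γ\G → V^*`
(`T5EquivariantDescent`: the dictionary «holomorphic 1-form = K_1-equivariant (𝔭⁺)^*-valued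
function») have a pointwise wedge `F ∧ F′ : Γ\G → V [⋀^Fin 2]→ₗ 𝕜` (`T5EquivariantWedge`:
`pointwiseQuot`), which is equivariant for the contragredient action on 2-forms
(`T5TopFormCharacter`: `topDual`), hence — since 2-forms on a 2-dimensional `V` are one-dimensional
— its scalar component `x ↦ minor e (F x) (F′ x)` transforms by the character `topChar ρ` under
right translation by `K`: `s (x · k) = topChar ρ k⁻¹ * s x = det (ρ k) * s x`.

This is the kernel form of «the wedge of two holomorphic 1-forms is a scalar function on
`Γ_j\G_1` of `K_1`-type `∧²(𝔭⁺)^* ≅ ℂ_det`» (N1 ID-4(b)–(c), route-2 §10.4's det-component):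
the scalar picked out by the wedge is a vector of the stated `K_1`-type in `C^∞(Γ\G)`.

* `isEquivariantBilinear_wedgeₗ` — `wedgeₗ` is `K`-equivariant for `(ρ.dual, ρ.dual, topDual ρ)`;
* `isRightEquivariantQuot_wedge` — the pointwise wedge of two `ρ.dual`-equivariant functions on
  `Γ\G` is `topDual ρ`-equivariant;
* `wedgeScalar`, `wedgeScalar_rmul` — its scalar component transforms by `topChar ρ`;
* `wedgeScalar_rmul_of_topChar_eq_one` — invariant under the kernel of the character;
* the same on `G` (`isRightEquivariant_wedge`, `wedgeScalarG_mul`).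

What stays prose: that `𝔭⁺` is the representation `std₂ ⊗ z⁻¹` of `K_1 = U(2) × U(1)` (Liu Lemma
D.2), so that `topChar` is the character `det⁻¹ ⊗ z²` in those coordinates.
-/

namespace Summit.Ventures.HodgeRepro2.T5WedgeScalarType

open Summit.Ventures.HodgeRepro2.T5EquivariantDescent
open Summit.Ventures.HodgeRepro2.T5EquivariantWedge
open Summit.Ventures.HodgeRepro2.T5TopFormCharacter
open Summit.Ventures.HodgeRepro2.T5WedgeDet

variable {G : Type*} [Group G] {Γ K : Subgroup G}
variable {𝕜 : Type*} [Field 𝕜] {V : Type*} [AddCommGroup V] [Module 𝕜 V]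

/-- **The wedge is an equivariant bilinear map** in the sense of `T5EquivariantWedge`:
`wedgeₗ (ρ.dual k f) (ρ.dual k g) = topDual ρ k (wedgeₗ f g)`. -/
theorem isEquivariantBilinear_wedgeₗ (ρ : Representation 𝕜 K V) :
    IsEquivariantBilinear (K := K) ρ.dual ρ.dual (topDual ρ) wedgeₗ :=
  fun k f g => wedgeₗ_equivariant ρ k f g

/-- The pointwise wedge of two right-`ρ.dual`-equivariant covector-valued functions on `G` is
right-`topDual ρ`-equivariant. -/
theorem isRightEquivariant_wedge (ρ : Representation 𝕜 K V) {f f' : G → (V →ₗ[𝕜] 𝕜)}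
    (hf : IsRightEquivariant K ρ.dual f) (hf' : IsRightEquivariant K ρ.dual f') :
    IsRightEquivariant K (topDual ρ) (pointwise wedgeₗ f f') :=
  isRightEquivariant_pointwise (isEquivariantBilinear_wedgeₗ ρ) hf hf'

/-- The pointwise wedge of two right-`ρ.dual`-equivariant covector-valued functions on `Γ\G` is
right-`topDual ρ`-equivariant. -/
theorem isRightEquivariantQuot_wedge (ρ : Representation 𝕜 K V)
    {F F' : RightQuot Γ → (V →ₗ[𝕜] 𝕜)} (hF : IsRightEquivariantQuot Γ K ρ.dual F)
    (hF' : IsRightEquivariantQuot Γ K ρ.dual F') :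
    IsRightEquivariantQuot Γ K (topDual ρ) (pointwiseQuot wedgeₗ F F') :=
  isRightEquivariantQuot_pointwiseQuot (isEquivariantBilinear_wedgeₗ ρ) hF hF'

/-- The scalar component of the pointwise wedge of two covector-valued functions on `Γ\G`, with
respect to a basis `e` of `V`: `x ↦ minor e (F x) (F′ x)` (the coefficient of `F ∧ F′` on `e.det`). -/
noncomputable def wedgeScalar (e : Module.Basis (Fin 2) 𝕜 V) (F F' : RightQuot Γ → (V →ₗ[𝕜] 𝕜)) :
    RightQuot Γ → 𝕜 :=
  fun x => minor e (F x) (F' x)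

/-- Evaluation of `wedgeScalar`. -/
@[simp] theorem wedgeScalar_apply (e : Module.Basis (Fin 2) 𝕜 V)
    (F F' : RightQuot Γ → (V →ₗ[𝕜] 𝕜)) (x : RightQuot Γ) :
    wedgeScalar e F F' x = minor e (F x) (F' x) := rfl

/-- The scalar component is the value of the pointwise wedge on the basis. -/
theorem wedgeScalar_eq (e : Module.Basis (Fin 2) 𝕜 V) (F F' : RightQuot Γ → (V →ₗ[𝕜] 𝕜))
    (x : RightQuot Γ) : wedgeScalar e F F' x = pointwiseQuot wedgeₗ F F' x e := by
  rw [wedgeScalar_apply, pointwiseQuot_apply, wedgeₗ_apply, minor_eq_wedge_apply_basis]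

/-- **The (2,0)-scalar has `K`-type `topChar ρ`**: for right-`ρ.dual`-equivariant `F, F′` on `Γ\G`,
`s := wedgeScalar e F F′` satisfies `s (x · k) = topChar ρ k⁻¹ * s x` (right translation by `k`
multiplies by the character of `k⁻¹`, the same convention as `IsRightEquivariantQuot`). -/
theorem wedgeScalar_rmul (e : Module.Basis (Fin 2) 𝕜 V) (ρ : Representation 𝕜 K V)
    {F F' : RightQuot Γ → (V →ₗ[𝕜] 𝕜)} (hF : IsRightEquivariantQuot Γ K ρ.dual F)
    (hF' : IsRightEquivariantQuot Γ K ρ.dual F') (x : RightQuot Γ) (k : K) :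
    wedgeScalar e F F' (rmul Γ x k) = topChar ρ k⁻¹ * wedgeScalar e F F' x := by
  rw [wedgeScalar_apply, wedgeScalar_apply, hF x k, hF' x k, minor_dual]

/-- Rewritten with the determinant: `s (x · k) = det (ρ k) * s x`, using
`topChar ρ k⁻¹ = det (ρ (k⁻¹)⁻¹) = det (ρ k)`. -/
theorem wedgeScalar_rmul' (e : Module.Basis (Fin 2) 𝕜 V) (ρ : Representation 𝕜 K V)
    {F F' : RightQuot Γ → (V →ₗ[𝕜] 𝕜)} (hF : IsRightEquivariantQuot Γ K ρ.dual F)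
    (hF' : IsRightEquivariantQuot Γ K ρ.dual F') (x : RightQuot Γ) (k : K) :
    wedgeScalar e F F' (rmul Γ x k) = LinearMap.det (ρ k) * wedgeScalar e F F' x := by
  rw [wedgeScalar_rmul e ρ hF hF', topChar_apply, inv_inv]

/-- The scalar is invariant under right translation by the kernel of the character. -/
theorem wedgeScalar_rmul_of_topChar_eq_one (e : Module.Basis (Fin 2) 𝕜 V)
    (ρ : Representation 𝕜 K V) {F F' : RightQuot Γ → (V →ₗ[𝕜] 𝕜)}
    (hF : IsRightEquivariantQuot Γ K ρ.dual F) (hF' : IsRightEquivariantQuot Γ K ρ.dual F')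
    (x : RightQuot Γ) {k : K} (hk : topChar ρ k⁻¹ = 1) :
    wedgeScalar e F F' (rmul Γ x k) = wedgeScalar e F F' x := by
  rw [wedgeScalar_rmul e ρ hF hF', hk, one_mul]

/-- The scalar component on `G` (before descent): `g ↦ minor e (f g) (f′ g)`. -/
noncomputable def wedgeScalarG (e : Module.Basis (Fin 2) 𝕜 V) (f f' : G → (V →ₗ[𝕜] 𝕜)) : G → 𝕜 :=
  fun g => minor e (f g) (f' g)

omit [Group G] in
/-- Evaluation of `wedgeScalarG`. -/
@[simp] theorem wedgeScalarG_apply (e : Module.Basis (Fin 2) 𝕜 V) (f f' : G → (V →ₗ[𝕜] 𝕜))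
    (g : G) : wedgeScalarG e f f' g = minor e (f g) (f' g) := rfl

/-- The same transformation law on `G`: `s (g k) = topChar ρ k⁻¹ * s g`. -/
theorem wedgeScalarG_mul (e : Module.Basis (Fin 2) 𝕜 V) (ρ : Representation 𝕜 K V)
    {f f' : G → (V →ₗ[𝕜] 𝕜)} (hf : IsRightEquivariant K ρ.dual f)
    (hf' : IsRightEquivariant K ρ.dual f') (g : G) (k : K) :
    wedgeScalarG e f f' (g * k) = topChar ρ k⁻¹ * wedgeScalarG e f f' g := by
  rw [wedgeScalarG_apply, wedgeScalarG_apply, hf g k, hf' g k, minor_dual]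

/-- The scalar component on `G` is left-`Γ`-invariant when `f, f′` are. -/
theorem isLeftInvariant_wedgeScalarG (e : Module.Basis (Fin 2) 𝕜 V) {f f' : G → (V →ₗ[𝕜] 𝕜)}
    (hf : IsLeftInvariant Γ f) (hf' : IsLeftInvariant Γ f') :
    IsLeftInvariant Γ (wedgeScalarG e f f') := by
  intro γ hγ g
  simp only [wedgeScalarG_apply, hf γ hγ g, hf' γ hγ g]

/-- The scalar component descends: `wedgeScalar e (descend f) (descend f′) = descend (wedgeScalarG e f f′)`. -/
theorem wedgeScalar_descend (e : Module.Basis (Fin 2) 𝕜 V) {f f' : G → (V →ₗ[𝕜] 𝕜)}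
    (hf : IsLeftInvariant Γ f) (hf' : IsLeftInvariant Γ f') :
    wedgeScalar e (descend Γ f hf) (descend Γ f' hf') =
      descend Γ (wedgeScalarG e f f') (isLeftInvariant_wedgeScalarG e hf hf') := by
  funext x
  induction x using Quotient.inductionOn' with
  | h g => rfl

end Summit.Ventures.HodgeRepro2.T5WedgeScalarType
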